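import Summits.BirchSwinnertonDyer.BirchSwinnertonDyer.Theorems.PrintCFramBottomClassIndexLawFiveLeKolyvaginTransport
import HarnessLib

/-!
# Route `PrintCFram`, crux C2 `BottomClassIndexLawFiveLe` (stmt-BirchSwinnertonDyer-20372), line `eisenstein-resource-bdp-line`:
# the v8 END STATE — the Kolyvagin stub in its «one model, one datum» form

Cell `bsd-print-cfram`, LEAD seat `bsd-line-cfram-p1` (generation g6), `--supports stmt-BirchSwinnertonDyer-20372` (helper); sequel of
`…KolyvaginTransport` (§5: BSD_p and the UPPER half move along ℚ-isogenies; «has a Kriz–Li datum» is a property of the isogeny class).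
HONEST FRAMING. The crux C2 is CLASS-WIDE and stays OPEN; no definition, no named fact, no `sorry`; the theorem is CONDITIONAL on the seven
citations, Kriz–Li Thm. 1.20 and the two RESEARCH statements of skeleton v8. BSD is not proved by any of this; no summit statement is proved
by this seat.

* §6 `bottomClassIndexLawFiveLe_of_prints7_of_krizLi_of_kolyvaginUpperOneModel_of_flatInclOffKrizLi` — the crux BY NAME from prints7, Kriz–Li,
  β1 off the Kriz–Li locus, and the WEAKENED Kolyvagin stub: for every member `W` and every admissible Heegner field `K''` (`d` odd `< −4`, Heegner
  for `N_W`, `L(W^{(d)},1) ≠ 0`) SOME globally minimal `W₀` isogenous to `W` and SOME Heegner datum `(Dt₀, H₀, ι₀, P₀)` of `W₀` over `K''` satisfy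
  `ord_p #Ш(W₀/K'') + 2·v_p(c(Dt₀)) ≤ 2·ord_p [W₀(K''):ℤP₀]` (Tamagawa-free: `p ∤ ∏c_ℓ` on the class).

References: [KrizLi2019] Thm. 1.20; [GrigorovJorzaPatrikisSteinTarnita2009] Thm. 3.7; [FriedbergHoffstein1995] Thm. B; [MilneADT2006] Thm. I.7.3;
[JetchevSkinnerWan2017] §7.4.1.
-/



set_option autoImplicit false
-- the summit namespace `Summit.BirchSwinnertonDyer.BirchSwinnertonDyer` repeats the problem name by design (D-0017)
set_option linter.dupNamespace false

noncomputable section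

open scoped Classical

namespace Summit.BirchSwinnertonDyer.BirchSwinnertonDyer.Theorems.PrintCFram.KrizLiKolyvagin

open WeierstrassCurve NumberField IsDedekindDomain Field PowerSeries
  Literature.NumberTheory.EllipticCurves Literature.NumberTheory.EllipticCurves.GreenbergSelmer
  Literature.NumberTheory.EllipticCurves.GreenbergVatsal2000
  Literature.NumberTheory.EllipticCurves.ModularForms
  Literature.NumberTheory.EllipticCurves.KrizLi2019
  Literature.NumberTheory.GaloisCohomology
  Literature.NumberTheory.EllipticCurves.Rank1Residual
  Literature.NumberTheory.EllipticCurves.Rank1Residual.Typed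
  Literature.NumberTheory.GaloisRepresentations
  Summit.BirchSwinnertonDyer.Rank1Residual
  Summit.BirchSwinnertonDyer.Rank1Residual.Additive
  Summit.BirchSwinnertonDyer.Rank1Residual.X11b Summit.BirchSwinnertonDyer.Rank1Residual.X11b.AcSelmer
  Summit.BirchSwinnertonDyer.Rank1Residual.X11b.Halves
  Summit.BirchSwinnertonDyer.Rank1Residual.X12
  Summit.BirchSwinnertonDyer.Rank1Residual.X2.ResidualDevissageModules
  Summit.BirchSwinnertonDyer.BirchSwinnertonDyer.Theses.UniversalToricDescent
  Summit.BirchSwinnertonDyer.BirchSwinnertonDyer.Theorems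
  Summit.BirchSwinnertonDyer.BirchSwinnertonDyer.Theorems.SchneiderFree
  Summit.BirchSwinnertonDyer.BirchSwinnertonDyer.Theorems.UniversalToricDescentWaldspurgerFlat
  Summit.BirchSwinnertonDyer.BirchSwinnertonDyer.Theorems.UniversalToricDescentStrictPlace
  Summit.BirchSwinnertonDyer.BirchSwinnertonDyer.Theorems.RamifiedSevenEllipticUnits
  Summit.BirchSwinnertonDyer.BirchSwinnertonDyer.Theorems.PrintCFram
  Summit.BirchSwinnertonDyer.BirchSwinnertonDyer.Theorems.PrintCFram.EisensteinResourceBdpLine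

/-! ## §6 The v8 END STATE: the Kolyvagin stub in its «one model, one datum» form -/

section EndStateV8

/-- **END STATE v8 of line `eisenstein-resource-bdp-line`: `BottomClassIndexLawFiveLe` BY NAME from** (i) the seven citations of `stub_prints`,
(ii) Kriz–Li 2019 Thm. 1.20, (iii) the WEAKENED Kolyvagin stub `stub_kolyvaginUpper_borelCM_oneModel` — for every class member `W` (`r_an = 1`) and
every admissible Heegner field `K''` of `N_W` (`d` odd `< −4`, `L(W^{(d)},1) ≠ 0`) SOME globally minimal `W₀` isogenous to `W` over `ℚ` and SOME Heegner
datum `(Dt₀, H₀, ι₀, P₀)` of `W₀` over `K''` satisfy the Tamagawa-free UPPER index half `ord_p #Ш(W₀/K'') + 2·v_p(c(Dt₀)) ≤ 2·ord_p [W₀(K''):ℤP₀]` (the Tamagawa term is void on the class, `p ∤ ∏c_ℓ` for CM and `p ≥ 5`) — and (iv) β1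
restricted to the members with no Kriz–Li datum. Pointwise in `W`: with a Kriz–Li datum over `K''`, §5
`bsdp_cmRamified_of_krizLiDatum_of_isIsogenous_indexUpper`; without, a Friedberg–Hoffstein field `K''` (auxiliary modulus `6`, from `ToricPublishedInputs`)
and §5 `bsdp_cmRamified_of_flatIncl_of_isIsogenous_indexUpper` with β1 for `W₀` (no Kriz–Li datum for `W₀` either, `exists_krizLiDatum_of_isIsogenous`).
CONDITIONAL on (i)–(iv); (iii) and (iv) are RESEARCH. BSD is not proved by any of this.
[cite: KrizLi2019, Thm. 1.20 (pp. 7–8)] [cite: GrigorovJorzaPatrikisSteinTarnita2009, Thm. 3.7 and Props. 5.2–5.4] [cite: FriedbergHoffstein1995, Thm. B]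
[cite: MilneADT2006, Thm. I.7.3] -/
theorem bottomClassIndexLawFiveLe_of_prints7_of_krizLi_of_kolyvaginUpperOneModel_of_flatInclOffKrizLi
    (hprints : Hsieh2014.thmA_exists_isHsiehLFunction_unrPeriod_anyLevel ∧
      LiuZhangZhang2018.thm151_thm153_modularCurve_heegnerVector_additive ∧
      ToricPublishedInputs ∧
      (∀ (K : Type) [Field K] [NumberField K], poitouTate_sha_tateDual K) ∧
      bsdTriple_of_hasCM_of_L_one_ne_zero ∧ hasEntireLFunction_rat ∧ bsdRHS_eq_of_isIsogenous)
    (hKL : KrizLi2019.thm120_padicLogHeegner_unit_of_bernoulli)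
    (hKoUp : ∀ (W : WeierstrassCurve ℚ) [W.IsElliptic] [W.IsGloballyMinimal] (p : ℕ) [Fact p.Prime],
      W.HasCM → CMRamified W p → 5 ≤ p → W.analyticRank = 1 →
      ∀ (N : ℕ) [NeZero N] (K : Type) [Field K] [NumberField K],
        W.conductorNorm ℤ = N → IsImaginaryQuadratic K → Odd (NumberField.discr K) → NumberField.discr K < -4 →
        SatisfiesHeegnerHypothesis N K → (W.quadraticTwist (NumberField.discr K : ℚ)).entireLFunction 1 ≠ 0 →
        ∃ (W₀ : WeierstrassCurve ℚ) (_ : W₀.IsElliptic) (_ : W₀.IsGloballyMinimal) (Dt₀ : ModularParametrizationData W₀ N)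
          (H₀ : HeegnerDatum N (NumberField.discr K)) (ι₀ : K →+* ℂ) (P₀ : (W₀.baseChange K).toAffine.Point),
          IsIsogenous W W₀ ∧ WeierstrassCurve.Affine.Point.map ι₀.toRatAlgHom P₀ = heegnerPointComplex Dt₀ H₀ ∧
          padicValNat p (W₀.baseChange K).shaOrder + 2 * padicValNat p Dt₀.c.natAbs ≤
            2 * padicValNat p (AddSubgroup.zmultiples P₀).index)
    (hInclOff : ∀ (p : ℕ) [Fact p.Prime] (W : WeierstrassCurve ℚ) [W.IsElliptic] [W.IsGloballyMinimal],
      W.HasCM → CMRamified W p → 5 ≤ p → W.analyticRank = 1 →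
      (¬ ∃ (N : ℕ) (_ : NeZero N) (K : Type) (_ : Field K) (_ : NumberField K) (Dt : ModularParametrizationData W N)
          (H : HeegnerDatum N (NumberField.discr K)) (ι : K →+* ℂ) (P : (W.baseChange K).toAffine.Point)
          (f : ℕ) (_ : NeZero f) (ψ : DirichletCharacter ℚ_[p] f) (ω : DirichletCharacter ℚ_[p] p)
          (εK : DirichletCharacter ℚ_[p] (NumberField.discr K).natAbs),
          W.conductorNorm ℤ = N ∧ IsImaginaryQuadratic K ∧ SatisfiesHeegnerHypothesis N K ∧ Odd (NumberField.discr K) ∧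
          NumberField.discr K < -4 ∧ (W.quadraticTwist (NumberField.discr K : ℚ)).entireLFunction 1 ≠ 0 ∧
          WeierstrassCurve.Affine.Point.map ι.toRatAlgHom P = heegnerPointComplex Dt H ∧
          ψ.IsPrimitive ∧ KrizLi2019.IsTeichmullerCharacter ω ∧
          (∀ ℓ : ℕ, ℓ.Prime → ¬ (ℓ ∣ p * W.conductorNorm ℤ) →
            ‖((W.LFunction ℓ : ℤ) : ℚ_[p]) - (ψ (ℓ : ZMod f) + ψ⁻¹ (ℓ : ZMod f) * ω (ℓ : ZMod p))‖ < 1) ∧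
          ψ (p : ZMod f) ≠ 1 ∧ KrizLi2019.primVal (KrizLi2019.invMulOmega ψ ω) p ≠ 1 ∧
          (∀ ℓ : ℕ, (hℓ : ℓ.Prime) → ℓ ≠ p →
            (haveI := Fact.mk hℓ; ¬ W.HasGoodReductionAtPrime ℓ ∧ ¬ W.HasMultiplicativeReductionAtPrime ℓ) →
            ψ (ℓ : ZMod f) ≠ 1 ∧ KrizLi2019.primVal (KrizLi2019.invMulOmega ψ ω) ℓ ≠ 1) ∧
          KrizLi2019.IsKroneckerCharacterOf K εK ∧
          ¬ (‖KrizLi2019.bernoulliOnePrim (KrizLi2019.bernoulliCharOne ψ εK) *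
              KrizLi2019.bernoulliOnePrim (KrizLi2019.bernoulliCharTwo ψ εK ω)‖ ≤ (p : ℝ)⁻¹)) →
      ∀ (N : ℕ) [NeZero N] (K : Type) [Field K] [NumberField K] (Dt : ModularParametrizationData W N),
      W.conductorNorm ℤ = N → IsImaginaryQuadratic K → SatisfiesHeegnerHypothesis N K →
      ∀ (κ : ZpExtension K p), κ.IsAnticyclotomic → ∀ (γ : Field.absoluteGaloisGroup K) [Fact (κ.IsTopGenerator γ)]
        (𝔭 : HeightOneSpectrum (𝓞 K)), ((p : ℕ) : 𝓞 K) ∈ 𝔭.asIdeal → 𝔭.asIdeal.ramificationIdx (𝓞 ℚ) = 1 →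
        𝔭.asIdeal.inertiaDeg (𝓞 ℚ) = 1 → ∀ (𝔭' : HeightOneSpectrum (𝓞 K)), ((p : ℕ) : 𝓞 K) ∈ 𝔭'.asIdeal → 𝔭' ≠ 𝔭 →
        ∀ (ι' : PadicAlgCl p ≃+* ℂ), SchneiderFree.BranchInducesPrime p ι' 𝔭 →
        ∀ (ΩK : ℂ) (Ωp : ℂ_[p]) (Q : PowerSeries (PadicComplexInt p)), ΩK ≠ 0 → Ωp ≠ 0 →
          R1.IsBDPLFunctionInt p ι' 𝔭 κ γ Dt.f ΩK Ωp Q →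
          Module.IsTorsion (IwasawaAlgebra p) (XAc (W.baseChange K) p κ 𝔭' ∅ γ) →
          (XAc.charIdeal (W.baseChange K) p κ 𝔭' ∅ γ).map (PowerSeries.map (R1.toCpInt p)) ≤ Ideal.span {Q}) :
    Summit.BirchSwinnertonDyer.BirchSwinnertonDyer.Theses.PrintCFram.BottomClassIndexLawFiveLe := by
  intro _hGZK W _ _ p _ hCM hram h5 hr
  have hp : p.Prime := Fact.out
  have hp2 : p ≠ 2 := by omega
  obtain ⟨-, -, hF, -, -, -, -⟩ := id hprints
  by_cases hKLd : ∃ (N : ℕ) (_ : NeZero N) (K : Type) (_ : Field K) (_ : NumberField K) (Dt : ModularParametrizationData W N)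
          (H : HeegnerDatum N (NumberField.discr K)) (ι : K →+* ℂ) (P : (W.baseChange K).toAffine.Point)
          (f : ℕ) (_ : NeZero f) (ψ : DirichletCharacter ℚ_[p] f) (ω : DirichletCharacter ℚ_[p] p)
          (εK : DirichletCharacter ℚ_[p] (NumberField.discr K).natAbs),
          W.conductorNorm ℤ = N ∧ IsImaginaryQuadratic K ∧ SatisfiesHeegnerHypothesis N K ∧ Odd (NumberField.discr K) ∧
          NumberField.discr K < -4 ∧ (W.quadraticTwist (NumberField.discr K : ℚ)).entireLFunction 1 ≠ 0 ∧
          WeierstrassCurve.Affine.Point.map ι.toRatAlgHom P = heegnerPointComplex Dt H ∧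
          ψ.IsPrimitive ∧ KrizLi2019.IsTeichmullerCharacter ω ∧
          (∀ ℓ : ℕ, ℓ.Prime → ¬ (ℓ ∣ p * W.conductorNorm ℤ) →
            ‖((W.LFunction ℓ : ℤ) : ℚ_[p]) - (ψ (ℓ : ZMod f) + ψ⁻¹ (ℓ : ZMod f) * ω (ℓ : ZMod p))‖ < 1) ∧
          ψ (p : ZMod f) ≠ 1 ∧ KrizLi2019.primVal (KrizLi2019.invMulOmega ψ ω) p ≠ 1 ∧
          (∀ ℓ : ℕ, (hℓ : ℓ.Prime) → ℓ ≠ p →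
            (haveI := Fact.mk hℓ; ¬ W.HasGoodReductionAtPrime ℓ ∧ ¬ W.HasMultiplicativeReductionAtPrime ℓ) →
            ψ (ℓ : ZMod f) ≠ 1 ∧ KrizLi2019.primVal (KrizLi2019.invMulOmega ψ ω) ℓ ≠ 1) ∧
          KrizLi2019.IsKroneckerCharacterOf K εK ∧
          ¬ (‖KrizLi2019.bernoulliOnePrim (KrizLi2019.bernoulliCharOne ψ εK) *
              KrizLi2019.bernoulliOnePrim (KrizLi2019.bernoulliCharTwo ψ εK ω)‖ ≤ (p : ℝ)⁻¹)
  · -- ON the Kriz–Li locus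
    obtain ⟨N, _, K, _, _, Dt, H, ι, P, f, _, ψ, ω, εK, hN, hK, hHN, hodd, hd4, hLt, hP, hψ, hω, hss, h1, h1', h3, hεK, h4⟩ :=
      hKLd
    obtain ⟨W₀, _, _, Dt₀, H₀, ι₀, P₀, hiso, hP₀, hup₀⟩ := hKoUp W p hCM hram h5 hr N K hN hK hodd hd4 hHN hLt
    have hpr := hprints
    obtain ⟨-, -, ⟨-, -, hGZK, -⟩, -, -, hmod, hCassels⟩ := hpr
    exact RubinFormulaZpBsdp.ramifiedCMBottomClassIndexLawAtZp_of_bsdp hCassels hmod hGZK hr.le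
      (bsdp_cmRamified_of_krizLiDatum_of_isIsogenous_indexUpper hprints hKL W hCM hram h5 hr N K hN hK hHN hodd hd4 hLt f ψ ω hψ hω hss
        h1 h1' h3 εK hεK h4 W₀ hiso Dt₀ H₀ ι₀ P₀ hP₀ (fun _ ↦ hup₀))
  · -- OFF the Kriz–Li locus: a Friedberg–Hoffstein field, then β1 for the isogenous model at that datum
    obtain ⟨hGZ, hKo, hGZK, hmod, hmodP, hCassels, hGZ73, hFH, hpar, hHP⟩ := id hF
    haveI hN0 : NeZero (W.conductorNorm ℤ) := ⟨W.conductorNorm_pos_holds.ne'⟩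
    have hw : W.rootNumber = -1 := by
      rcases W.rootNumber_eq_one_or with h | h
      · exfalso
        have heven : Even W.analyticRank := (hpar W).mpr h
        rw [hr] at heven
        exact Nat.not_even_one heven
      · exact h
    obtain ⟨K, _, _, hK, -, hHN, hH6, hLt⟩ := hFH W hw 6 (by norm_num) 0
    have hodd : Odd (NumberField.discr K) := by
      have h8 := Literature.SatisfiesHeegnerHypothesis.discr_emod_eight hK.1 hH6 (by norm_num : (2 : ℕ) ∣ 6)
      rw [Int.odd_iff]; omega
    have hd4 : NumberField.discr K < -4 :=
      discr_lt_neg_four_of_three_split hK (hH6 3 Nat.prime_three (by norm_num : (3 : ℕ) ∣ 6))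
    obtain ⟨W₀, _, _, Dt₀, H₀, ι₀, P₀, hiso, hP₀, hup₀⟩ := hKoUp W p hCM hram h5 hr (W.conductorNorm ℤ) K rfl hK hodd hd4 hHN hLt
    have hCM₀ : W₀.HasCM := X12.hasCM_of_isIsogenous hiso hCM
    have hram₀ : CMRamified W₀ p := (X12.cmRamified_iff_of_isIsogenous hiso hCM p).mp hram
    have hr₀ : W₀.analyticRank = 1 := by rw [← analyticRank_eq_of_isIsogenous LFunction_eq_of_isIsogenous_holds hiso]; exact hr
    have hN₀ : W₀.conductorNorm ℤ = W.conductorNorm ℤ := (conductorNorm_eq_of_isIsogenous_of_modularity hmodP W W₀ hiso).symm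
    -- no Kriz–Li datum for `W₀` either
    have hKLd₀ := fun h ↦ hKLd (exists_krizLiDatum_of_isIsogenous (p := p) hF hiso.symm_of_charZero hCM₀ h)
    exact RubinFormulaZpBsdp.ramifiedCMBottomClassIndexLawAtZp_of_bsdp hCassels hmod hGZK hr.le
      (bsdp_cmRamified_of_flatIncl_of_isIsogenous_indexUpper hprints W hCM hram h5 hr (W.conductorNorm ℤ) K rfl hK hHN hodd hd4 hLt W₀ hiso
        Dt₀ H₀ ι₀ P₀ hP₀
        (fun κ hκ γ _ 𝔭 h𝔭 he hf 𝔭' h𝔭' hne ι' hind ΩK Ωp Q hΩK hΩp hBDP htors ↦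
          hInclOff p W₀ hCM₀ hram₀ h5 hr₀ hKLd₀ (W.conductorNorm ℤ) K Dt₀ hN₀ hK hHN κ hκ γ 𝔭 h𝔭 he hf 𝔭' h𝔭' hne ι' hind ΩK Ωp Q
            hΩK hΩp hBDP htors)
        (fun _ ↦ hup₀))

end EndStateV8

end Summit.BirchSwinnertonDyer.BirchSwinnertonDyer.Theorems.PrintCFram.KrizLiKolyvagin

end
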